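import Summits.CriticalPhenomena.SAWScalingLimit.Theorems.SAWRenewalTightnessAnnularMassDecayLastRenewalDefs
import Literature.Probability.RandomPlanarGeometry.UniformSAWCurveLaw

/-!
# Crux `SAWRenewalTightness.AnnularMassDecay` (stmt-CriticalPhenomena-4729), line `last-renewal-delocalization`:
# S1 `stub_lastRenewalDecoupling` — the last-renewal cut, as an inequality of finite sums

For the crux geometry `1 ≤ r < R ≤ |u - z|`, frame `e = frameDir z u`, level `ℓ = botLevel z r u = |u - z| - r`
and every `N`:  `annMass z r R u N ≤ Σ_{x ∈ box 2 N} brMass e u x N · pfxMass z r R u x N`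
(registered stub `stub_lastRenewalDecoupling` of the checked skeleton of the line; vocabulary from
`…AnnularMassDecayLastRenewalDefs`).

Proof.  Every walk `ω ∈ saws 2 n`, `n ≤ N`, counted by `annMass` lives in the open half-plane `{h > 0}` after
time `0` (its vertices are at distance `< R ≤ |u - z|` from `z`, and projection onto the unit vector `e` is
`1`-Lipschitz: `lrd_sub_ht_le_dist`), so `0` is an `e`-renewal time of `ω` at height `0 < ℓ` (`lrd_good_zero`).
Cut `ω` at its LAST renewal time `t°` of height `< ℓ` (`Nat.findGreatest`): the head `SAW.Zd.headPart t° ω` is an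
`e`-bridge from `u` with offset `ω t° ∈ box 2 N` (`lrd_head_spec`), and the tail
`SAW.Zd.tailPart t° (n - t°) ω` is a last excursion from `u + ω t°` — it lives strictly above its start, a
renewal of the tail at height `< ℓ` would be a later renewal of `ω` at height `< ℓ`, its interior vertices are
interior vertices of `ω`, same endpoint (`lrd_tail_spec`).  The map `ω ↦ (ω t°, head, tail)` is injective
(`SAW.Zd.concatWalk_headPart_tailPart`) and `x_c^n = x_c^{t°} x_c^{n - t°}`, so summing the nonnegative terms
over its image gives the bound (`lrd_abstract_injection`: `Finset.sum_image` + `Finset.sum_le_sum_of_subset_of_nonneg`).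
This is the decomposition "bridge irreducible above height `ℓ` ⊕ rest" of Dyhr–Gilbert–Kennedy–Lawler–Passon,
J. Stat. Phys. 144 (2011), arXiv:1008.4321 §2, taken at the level of the target disc; renewal times as in
Duminil-Copin–Hammond, Comm. Math. Phys. 324 (2013) §2.3; bridges as in Madras–Slade (1993) §1.2, §4.2.
-/

noncomputable section

namespace Summit.CriticalPhenomena.SAWScalingLimit.Theorems.AnnularMassDecay.LastRenewal

open scoped BigOperators Classical ComplexConjugate
open Literature.Probability.LatticeModels Literature.Probability.RandomPlanarGeometry
open Summit.CriticalPhenomena.SAWScalingLimit.Theorems.AnnularMassDecay.Negative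
  (annMass criticalFugacity_pos)

/-! ## Geometry of the crux frame: the disc `B(z, R)` lies in the half-plane `{h > 0}` -/

/-- The crux frame direction is a unit vector (for `u ≠ z`). [folklore] -/
theorem lrd_norm_frameDir {z : ℂ} {u : Site 2} (hD : 0 < dist (Site.toComplex u) z) :
    ‖frameDir z u‖ = 1 := by
  have h1 : ‖z - Site.toComplex u‖ = dist (Site.toComplex u) z := by rw [dist_eq_norm, norm_sub_rev]
  unfold frameDir
  rw [norm_div, Complex.norm_real, Real.norm_eq_abs, abs_of_pos hD, h1, div_self hD.ne']

/-- Projection onto the unit direction `e = frameDir z u` is `1`-Lipschitz: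
`|u - z| - h(v) = Re((z - v) ē) ≤ |v - z|` for every lattice point `v`. [folklore] -/
theorem lrd_sub_ht_le_dist {z : ℂ} {u : Site 2} (hD : 0 < dist (Site.toComplex u) z) (v : Site 2) :
    dist (Site.toComplex u) z - ht (frameDir z u) u v ≤ dist (Site.toComplex v) z := by
  set D : ℝ := dist (Site.toComplex u) z with hDdef
  set w : ℂ := z - Site.toComplex u with hwdef
  have hw : ‖w‖ = D := by rw [hwdef, hDdef, dist_eq_norm, norm_sub_rev]
  have hre : (w * conj (frameDir z u)).re = D := by
    unfold frameDir
    rw [← hwdef, ← hDdef, map_div₀, Complex.conj_ofReal, mul_div_assoc', Complex.div_ofReal_re,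
      Complex.mul_conj, Complex.ofReal_re, Complex.normSq_eq_norm_sq, hw, pow_two,
      mul_div_assoc, div_self hD.ne', mul_one]
  have hsplit : D - ht (frameDir z u) u v = ((z - Site.toComplex v) * conj (frameDir z u)).re := by
    have : z - Site.toComplex v = w - (Site.toComplex v - Site.toComplex u) := by rw [hwdef]; ring
    rw [this, sub_mul, Complex.sub_re, hre]
    rfl
  rw [hsplit]
  calc ((z - Site.toComplex v) * conj (frameDir z u)).re ≤ ‖(z - Site.toComplex v) * conj (frameDir z u)‖ :=
        Complex.re_le_norm _
    _ = dist (Site.toComplex v) z := by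
        rw [norm_mul, Complex.norm_conj, lrd_norm_frameDir hD, mul_one, dist_eq_norm, norm_sub_rev]

/-- A lattice point of the open disc `|· - z| < R`, `R ≤ |u - z|`, has strictly positive height in the crux frame
at `u`. [folklore] -/
theorem lrd_ht_pos {z : ℂ} {u v : Site 2} {R : ℝ} (huz : R ≤ dist (Site.toComplex u) z)
    (hv : dist (Site.toComplex v) z < R) : 0 < ht (frameDir z u) u v := by
  have hD : 0 < dist (Site.toComplex u) z := lt_of_lt_of_le (lt_of_le_of_lt dist_nonneg hv) huz
  have h := lrd_sub_ht_le_dist hD v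
  linarith

/-- Every vertex after time `0` of a walk counted by `annMass z r R u N` (interior vertices in the open annulus
`r < |· - z| < R`, endpoint in `|· - z| ≤ r`, with `r < R ≤ |u - z|`) has strictly positive height: the walk is
an `e`-half-plane walk from `u`. [folklore] -/
theorem lrd_walk_ht_pos {z : ℂ} {r R : ℝ} {u : Site 2} (hrR : r < R) (huz : R ≤ dist (Site.toComplex u) z)
    {n : ℕ} {ω : ℕ → Site 2}
    (hC : (∀ i, 0 < i → i < n → r < dist (Site.toComplex (u + ω i)) z ∧
      dist (Site.toComplex (u + ω i)) z < R) ∧ dist (Site.toComplex (u + ω n)) z ≤ r) :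
    ∀ i, 0 < i → i ≤ n → 0 < ht (frameDir z u) u (u + ω i) := by
  intro i hi hin
  rcases hin.lt_or_eq with hlt | rfl
  · exact lrd_ht_pos huz (hC.1 i hi hlt).2
  · exact lrd_ht_pos huz (hC.2.trans_lt hrR)

/-! ## The cut at the last renewal time strictly below the level `ℓ` -/

/-- Time `0` is an `e`-renewal time of a counted walk, at height `0 < ℓ`. [folklore] -/
theorem lrd_good_zero {z : ℂ} {r R : ℝ} {u : Site 2} (hrR : r < R) (huz : R ≤ dist (Site.toComplex u) z)
    {n : ℕ} {ω : ℕ → Site 2} (hω : ω ∈ SAW.Zd.saws 2 n)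
    (hC : (∀ i, 0 < i → i < n → r < dist (Site.toComplex (u + ω i)) z ∧
      dist (Site.toComplex (u + ω i)) z < R) ∧ dist (Site.toComplex (u + ω n)) z ≤ r) :
    IsRen (frameDir z u) u (fun i => u + ω i) n 0 ∧ ht (frameDir z u) u (u + ω 0) < botLevel z r u := by
  have h0 : ht (frameDir z u) u (u + ω 0) = 0 := by rw [(SAW.Zd.mem_saws.1 hω).1, add_zero, ht_self]
  refine ⟨⟨fun i hi => absurd hi (Nat.not_lt_zero i), fun j hj hjn => ?_⟩, ?_⟩
  · show ht (frameDir z u) u (u + ω 0) < ht (frameDir z u) u (u + ω j)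
    rw [h0]
    exact lrd_walk_ht_pos hrR huz hC j hj hjn
  · rw [h0]
    unfold botLevel
    linarith

/-- **The head of the cut.**  If `t ≤ n` is an `e`-renewal time of the counted walk `ω ∈ saws 2 n` (`n ≤ N`), then
the cut point `ω t` lies in `box 2 N` and `SAW.Zd.headPart t ω ∈ saws 2 t` is an `e`-bridge from `u` with endpoint
offset `ω t` (positivity: half-plane property; maximality of the end: the renewal's past clause).
[cite: MadrasSlade1993, §1.2, Definition 1.2.4] -/
theorem lrd_head_spec {z : ℂ} {r R : ℝ} {u : Site 2} (hrR : r < R) (huz : R ≤ dist (Site.toComplex u) z)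
    {N n t : ℕ} {ω : ℕ → Site 2} (hω : ω ∈ SAW.Zd.saws 2 n) (hnN : n ≤ N)
    (hC : (∀ i, 0 < i → i < n → r < dist (Site.toComplex (u + ω i)) z ∧
      dist (Site.toComplex (u + ω i)) z < R) ∧ dist (Site.toComplex (u + ω n)) z ≤ r)
    (htn : t ≤ n)
    (hG : IsRen (frameDir z u) u (fun i => u + ω i) n t ∧ ht (frameDir z u) u (u + ω t) < botLevel z r u) :
    ω t ∈ box 2 N ∧ SAW.Zd.headPart t ω ∈ SAW.Zd.saws 2 t ∧
      (IsBr (frameDir z u) u t (SAW.Zd.headPart t ω) ∧ SAW.Zd.headPart t ω t = ω t) := by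
  obtain ⟨h0, -, hadj, -⟩ := SAW.Zd.mem_saws.1 hω
  have hω' : ω ∈ SAW.Zd.saws 2 (t + (n - t)) := by rwa [Nat.add_sub_of_le htn]
  refine ⟨?_, SAW.Zd.headPart_mem_saws hω', ⟨?_, ?_⟩, by simp only [SAW.Zd.headPart, min_self]⟩
  · rw [mem_box]
    intro j
    have h := SAW.Zd.abs_apply_le_of_adj h0 hadj t htn j
    have htN : (t : ℤ) ≤ N := by exact_mod_cast htn.trans hnN
    exact abs_le.1 (h.trans htN)
  · intro i hi hit
    simp only [SAW.Zd.headPart, min_eq_left hit]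
    exact lrd_walk_ht_pos hrR huz hC i hi (hit.trans htn)
  · intro i hit
    simp only [SAW.Zd.headPart, min_eq_left hit, min_self]
    rcases hit.lt_or_eq with hlt | rfl
    · exact hG.1.1 i hlt
    · exact le_rfl

/-- **The tail of the cut.**  If `t ≤ n` is an `e`-renewal time at height `< ℓ` of the counted walk
`ω ∈ saws 2 n` and NO later time `t' ≤ n` is, then `SAW.Zd.tailPart t (n - t) ω ∈ saws 2 (n - t)` satisfies
the five clauses of the last-excursion family `pfxMass` at the offset `ω t`: start below `ℓ`; strictly above
its start afterwards (the renewal's future clause); no renewal at height `< ℓ` (it would be a later renewal of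
`ω` at height `< ℓ`); interior vertices in the annulus; endpoint in the disc.
[cite: DyhrGilbertKennedyLawlerPasson2011, §2] -/
theorem lrd_tail_spec {z : ℂ} {r R : ℝ} {u : Site 2} {n t : ℕ} {ω : ℕ → Site 2}
    (hω : ω ∈ SAW.Zd.saws 2 n)
    (hC : (∀ i, 0 < i → i < n → r < dist (Site.toComplex (u + ω i)) z ∧
      dist (Site.toComplex (u + ω i)) z < R) ∧ dist (Site.toComplex (u + ω n)) z ≤ r)
    (htn : t ≤ n)
    (hG : IsRen (frameDir z u) u (fun i => u + ω i) n t ∧ ht (frameDir z u) u (u + ω t) < botLevel z r u)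
    (hmax : ∀ t', t < t' → t' ≤ n →
      ¬ (IsRen (frameDir z u) u (fun i => u + ω i) n t' ∧ ht (frameDir z u) u (u + ω t') < botLevel z r u)) :
    SAW.Zd.tailPart t (n - t) ω ∈ SAW.Zd.saws 2 (n - t) ∧
    (ht (frameDir z u) u (u + ω t) < botLevel z r u ∧
      (∀ s, 1 ≤ s → s ≤ n - t →
        ht (frameDir z u) u (u + ω t) < ht (frameDir z u) u (u + ω t + SAW.Zd.tailPart t (n - t) ω s)) ∧
      (∀ s, 1 ≤ s → s ≤ n - t →
        ht (frameDir z u) u (u + ω t + SAW.Zd.tailPart t (n - t) ω s) < botLevel z r u →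
          ¬ IsRen (frameDir z u) u (fun i => u + ω t + SAW.Zd.tailPart t (n - t) ω i) (n - t) s) ∧
      (∀ s, 1 ≤ s → s < n - t →
        r < dist (Site.toComplex (u + ω t + SAW.Zd.tailPart t (n - t) ω s)) z ∧
          dist (Site.toComplex (u + ω t + SAW.Zd.tailPart t (n - t) ω s)) z < R) ∧
      dist (Site.toComplex (u + ω t + SAW.Zd.tailPart t (n - t) ω (n - t))) z ≤ r) := by
  have hω' : ω ∈ SAW.Zd.saws 2 (t + (n - t)) := by rwa [Nat.add_sub_of_le htn]
  -- the positions of the tail are the positions of `ω` after time `t`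
  have key : ∀ s, s ≤ n - t → u + ω t + SAW.Zd.tailPart t (n - t) ω s = u + ω (t + s) := fun s hs => by
    simp only [SAW.Zd.tailPart, min_eq_left hs, add_add_sub_cancel]
  obtain ⟨⟨hpast, hfut⟩, hlev⟩ := hG
  refine ⟨SAW.Zd.tailPart_mem_saws hω', hlev, ?_, ?_, ?_, ?_⟩
  · -- strictly above the start: the future clause of the renewal time `t`
    intro s hs1 hs2
    rw [key s hs2]
    exact hfut (t + s) (by omega) (by omega)
  · -- a renewal `s` of the tail at height `< ℓ` would make `t + s` a renewal of `ω` at height `< ℓ`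
    intro s hs1 hs2 hlt hren
    obtain ⟨hpast', hfut'⟩ := hren
    rw [key s hs2] at hlt
    refine hmax (t + s) (by omega) (by omega) ⟨⟨fun i hi => ?_, fun j hj hjn => ?_⟩, hlt⟩
    · show ht (frameDir z u) u (u + ω i) ≤ ht (frameDir z u) u (u + ω (t + s))
      rcases lt_or_ge i t with hit | hit
      · exact (hpast i hit).trans (hfut (t + s) (by omega) (by omega)).le
      · obtain ⟨k, rfl⟩ : ∃ k, i = t + k := ⟨i - t, by omega⟩
        have h : ht (frameDir z u) u (u + ω t + SAW.Zd.tailPart t (n - t) ω k) ≤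
            ht (frameDir z u) u (u + ω t + SAW.Zd.tailPart t (n - t) ω s) := hpast' k (by omega)
        rwa [key k (by omega), key s hs2] at h
    · show ht (frameDir z u) u (u + ω (t + s)) < ht (frameDir z u) u (u + ω j)
      obtain ⟨k, rfl⟩ : ∃ k, j = t + k := ⟨j - t, by omega⟩
      have h : ht (frameDir z u) u (u + ω t + SAW.Zd.tailPart t (n - t) ω s) <
          ht (frameDir z u) u (u + ω t + SAW.Zd.tailPart t (n - t) ω k) := hfut' k (by omega) (by omega)
      rwa [key s hs2, key k (by omega)] at h
  · -- interior vertices of the tail are interior vertices of `ω`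
    intro s hs1 hs2
    rw [key s hs2.le]
    exact hC.1 (t + s) (by omega) (by omega)
  · -- same endpoint
    rw [key (n - t) le_rfl, Nat.add_sub_of_le htn]
    exact hC.2

/-! ## Finite-sum bookkeeping -/

/-- **Abstract last-renewal injection.**  `S n` are finite sets ("walks of length `n`"), `C n` the counted
members, `X` a finite set of cut points, `P x m` the admissible heads and `Q x k` the admissible tails at the cut
point `x`.  If every counted member `ω ∈ S n`, `n ≤ N`, has a cut time `cut n ω ≤ n`, a cut point
`pt n ω ∈ X`, a head `pre n ω ∈ S (cut n ω)` in `P`, a tail `suf n ω ∈ S (n - cut n ω)` in `Q`, and is recovered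
from them by `conc`, then the `c^n`-weighted count of the members of length `≤ N` is at most
`Σ_{x ∈ X} (Σ_{m ≤ N} Σ_{P-heads} c^m) · (Σ_{k ≤ N} Σ_{Q-tails} c^k)` (`c ≥ 0`): the cut map is injective and
the weights multiply. [folklore] -/
theorem lrd_abstract_injection {α γ : Type*} (c : ℝ) (hc : 0 ≤ c) (N : ℕ) (S : ℕ → Finset α)
    (C : ℕ → α → Prop) (X : Finset γ) (P Q : γ → ℕ → α → Prop)
    {instC : ∀ n, DecidablePred (C n)} {instP : ∀ x m, DecidablePred (P x m)}
    {instQ : ∀ x k, DecidablePred (Q x k)}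
    (cut : ℕ → α → ℕ) (pt : ℕ → α → γ) (pre suf : ℕ → α → α) (conc : ℕ → α → α → α)
    (hcut : ∀ n ω, ω ∈ S n → C n ω → n ≤ N →
      cut n ω ≤ n ∧ pt n ω ∈ X ∧ pre n ω ∈ S (cut n ω) ∧ P (pt n ω) (cut n ω) (pre n ω) ∧
        suf n ω ∈ S (n - cut n ω) ∧ Q (pt n ω) (n - cut n ω) (suf n ω) ∧
        conc (cut n ω) (pre n ω) (suf n ω) = ω) :
    ∑ n ∈ Finset.range (N + 1), ∑ _ω ∈ (S n).filter (C n), c ^ n ≤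
      ∑ x ∈ X, (∑ m ∈ Finset.range (N + 1), ∑ _β ∈ (S m).filter (P x m), c ^ m) *
        (∑ k ∈ Finset.range (N + 1), ∑ _η ∈ (S k).filter (Q x k), c ^ k) := by
  classical
  have eL : ∑ n ∈ Finset.range (N + 1), ∑ _ω ∈ (S n).filter (C n), c ^ n =
      ∑ p ∈ (Finset.range (N + 1)).sigma (fun n => (S n).filter (C n)), c ^ p.1 :=
    Finset.sum_sigma' _ _ fun n _ => c ^ n
  have eR : ∑ x ∈ X, (∑ m ∈ Finset.range (N + 1), ∑ _β ∈ (S m).filter (P x m), c ^ m) *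
        (∑ k ∈ Finset.range (N + 1), ∑ _η ∈ (S k).filter (Q x k), c ^ k) =
      ∑ w ∈ X.sigma (fun x => ((Finset.range (N + 1)).sigma (fun m => (S m).filter (P x m))).sigma
          (fun _ => (Finset.range (N + 1)).sigma (fun k => (S k).filter (Q x k)))),
        c ^ w.2.1.1 * c ^ w.2.2.1 := by
    rw [Finset.sum_sigma]
    refine Finset.sum_congr rfl fun x _ => ?_
    rw [Finset.sum_sigma, Finset.sum_sigma, Finset.sum_mul]
    refine Finset.sum_congr rfl fun m _ => ?_
    rw [Finset.sum_mul]
    refine Finset.sum_congr rfl fun β _ => ?_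
    rw [Finset.mul_sum, Finset.sum_sigma]
    refine Finset.sum_congr rfl fun k _ => ?_
    rw [Finset.mul_sum]
  have hw : ∀ p ∈ (Finset.range (N + 1)).sigma (fun n => (S n).filter (C n)),
      c ^ p.1 = c ^ cut p.1 p.2 * c ^ (p.1 - cut p.1 p.2) := by
    intro p hp
    simp only [Finset.mem_sigma, Finset.mem_filter, Finset.mem_range] at hp
    rw [← pow_add, Nat.add_sub_of_le (hcut p.1 p.2 hp.2.1 hp.2.2 (Nat.le_of_lt_succ hp.1)).1]
  rw [eL, eR, Finset.sum_congr rfl hw]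
  -- the cut map is injective: `ω = conc (cut) (pre) (suf)` and `n = cut + (n - cut)`
  have hinj : Set.InjOn
      (fun p : (Σ _ : ℕ, α) => (⟨pt p.1 p.2, ⟨cut p.1 p.2, pre p.1 p.2⟩, ⟨p.1 - cut p.1 p.2, suf p.1 p.2⟩⟩ :
        Σ _ : γ, Σ _ : (Σ _ : ℕ, α), (Σ _ : ℕ, α)))
      ((Finset.range (N + 1)).sigma (fun n => (S n).filter (C n))) := by
    intro p hp q hq hpq
    simp only [Finset.coe_sigma, Finset.mem_coe, Finset.mem_filter, Finset.mem_range,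
      Set.mem_sigma_iff] at hp hq
    simp only [Sigma.mk.injEq, heq_eq_eq] at hpq
    obtain ⟨-, ⟨hc', hpre⟩, hk, hsuf⟩ := hpq
    obtain ⟨hcp, -, -, -, -, -, hconcp⟩ := hcut p.1 p.2 hp.2.1 hp.2.2 (Nat.le_of_lt_succ hp.1)
    obtain ⟨hcq, -, -, -, -, -, hconcq⟩ := hcut q.1 q.2 hq.2.1 hq.2.2 (Nat.le_of_lt_succ hq.1)
    have h1 : p.1 = q.1 := by omega
    have h2 : p.2 = q.2 := by rw [← hconcp, ← hconcq, hc', hpre, hsuf]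
    exact Sigma.ext h1 (heq_of_eq h2)
  -- sum over the image of the cut map, a subset of the index set of the right-hand side
  refine (le_of_eq (Finset.sum_image (f := fun w : (Σ _ : γ, Σ _ : (Σ _ : ℕ, α), (Σ _ : ℕ, α)) =>
    c ^ w.2.1.1 * c ^ w.2.2.1) hinj).symm).trans
    (Finset.sum_le_sum_of_subset_of_nonneg (Finset.image_subset_iff.2 fun p hp => ?_) fun w _ _ =>
      mul_nonneg (pow_nonneg hc _) (pow_nonneg hc _))
  simp only [Finset.mem_sigma, Finset.mem_filter, Finset.mem_range] at hp ⊢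
  obtain ⟨hcn, hpt, hpre, hP, hsuf, hQ, -⟩ := hcut p.1 p.2 hp.2.1 hp.2.2 (Nat.le_of_lt_succ hp.1)
  exact ⟨hpt, ⟨by omega, hpre, hP⟩, by omega, hsuf, hQ⟩

/-! ## The stub -/

/-- **S1 · `stub_lastRenewalDecoupling`** — LAST-RENEWAL DECOUPLING.  For the crux geometry
(`1 ≤ r < R ≤ |u - z|`, `e = frameDir z u`, `ℓ = botLevel z r u = |u - z| - r`) and every `N`:
`annMass z r R u N ≤ Σ_{x ∈ box 2 N} b_N(u → u + x) · N°_N(u + x)`.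
Cut each counted walk at its last `e`-renewal time strictly below the level `ℓ` (`Nat.findGreatest`; time `0`
qualifies by the half-plane property): the head is an `e`-bridge from `u` (`lrd_head_spec`), the tail a last
excursion (`lrd_tail_spec`), the cut is injective (`SAW.Zd.concatWalk_headPart_tailPart`) and the weights
multiply (`lrd_abstract_injection`). [cite: DyhrGilbertKennedyLawlerPasson2011, §2] -/
theorem stub_lastRenewalDecoupling :
    ∀ (z : ℂ) (r R : ℝ), 1 ≤ r → r < R → ∀ (u : Site 2), R ≤ dist (Site.toComplex u) z → ∀ N : ℕ,
      annMass z r R u N ≤ ∑ x ∈ box 2 N, brMass (frameDir z u) u x N * pfxMass z r R u x N := by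
  intro z r R _ hrR u huz N
  -- `T n ω`: the last `e`-renewal time of `ω` at height `< ℓ` (`0` if there is none)
  obtain ⟨T, hT⟩ : ∃ T : ℕ → (ℕ → Site 2) → ℕ, ∀ n ω, T n ω ≤ n ∧
      (T n ω ≠ 0 → IsRen (frameDir z u) u (fun i => u + ω i) n (T n ω) ∧
        ht (frameDir z u) u (u + ω (T n ω)) < botLevel z r u) ∧
      ∀ ⦃t'⦄, T n ω < t' → t' ≤ n → ¬ (IsRen (frameDir z u) u (fun i => u + ω i) n t' ∧
        ht (frameDir z u) u (u + ω t') < botLevel z r u) :=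
    ⟨fun n ω => Nat.findGreatest (fun t => IsRen (frameDir z u) u (fun i => u + ω i) n t ∧
        ht (frameDir z u) u (u + ω t) < botLevel z r u) n,
      fun n ω => Nat.findGreatest_eq_iff.1 rfl⟩
  unfold annMass brMass pfxMass
  refine lrd_abstract_injection SAW.criticalFugacity criticalFugacity_pos.le N (SAW.Zd.saws 2) _
    (box 2 N) _ _ T (fun n ω => ω (T n ω)) (fun n ω => SAW.Zd.headPart (T n ω) ω)
    (fun n ω => SAW.Zd.tailPart (T n ω) (n - T n ω) ω) (fun m β η => SAW.Zd.concatWalk m β η) ?_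
  intro n ω hω hC hnN
  obtain ⟨hTn, hgT, hnT⟩ := hT n ω
  have hG : IsRen (frameDir z u) u (fun i => u + ω i) n (T n ω) ∧
      ht (frameDir z u) u (u + ω (T n ω)) < botLevel z r u := by
    rcases eq_or_ne (T n ω) 0 with h0 | h0
    · rw [h0]
      exact lrd_good_zero hrR huz hω hC
    · exact hgT h0
  obtain ⟨hbox, hhead, hbr⟩ := lrd_head_spec hrR huz hω hnN hC hTn hG
  obtain ⟨htail, hQ⟩ := lrd_tail_spec hω hC hTn hG fun t' h1 h2 => hnT h1 h2
  have hω' : ω ∈ SAW.Zd.saws 2 (T n ω + (n - T n ω)) := by rwa [Nat.add_sub_of_le hTn]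
  exact ⟨hTn, hbox, hhead, hbr, htail, hQ, SAW.Zd.concatWalk_headPart_tailPart hω'⟩

end Summit.CriticalPhenomena.SAWScalingLimit.Theorems.AnnularMassDecay.LastRenewal

end
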